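import Literature.Analysis.Complex.MontelOmittingTwoValues
import Literature.Analysis.Complex.RiemannMapping
import Mathlib.Analysis.Convex.Contractible
import HarnessLib

/-!
# Uniformization of plane domains, brick N1c (transport half): disc-lifting, sections and the `λ`-chart

PROOF-ONLY file (no definitions; abc-iut cell, seat abc-iut-w5-d089 gen 8, brick «UNIF-G1P · λ̃-TRANSPORT»
(= step K3b of abc-iut-w5-d038's N1c tower) of abc-iut-L4-t8's programme behind the named fact
`Complex.PlaneDomainDiscCovering`, GAP row G-L4t8g7-1).  Y. Fisher, J. H. Hubbard, B. S. Wittner, *A proof of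
the uniformization theorem for arbitrary plane domains*, Proc. Amer. Math. Soc. **104** (1988) 413–418: Lemma
3.1 p. 414 reduces a plane domain `U ⊆ ℂ ∖ {a, b}` to a domain inside the disc through a universal covering
`p : D → ℂ ∖ {a, b}` built from the modular function («there is such a `p` by Theorem 2.1»), and Part (c)
p. 415–416 transports liftings and extremality along `p`.  In the Ũ-free form of the argument used by the
programme, every lifting is of HOLOMORPHIC MAPS FROM THE UNIT DISC `𝔻`, BASED AT A POINT — the shape
«`∀ g` holomorphic `𝔻 → V`, `∀ y` with `P y = g 0`, `∃ ĝ` holomorphic `𝔻 → 𝔻`, `ĝ 0 = y`, `P ∘ ĝ = g`»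
(below: "based disc-lifting").  THIS FILE proves the transport statements in that shape:

* `Complex.holomorphicSections_of_discLift` — based disc-lifting for `F : 𝔻 → U` ⇒ holomorphic local
  sections of `F` over every disc `ball c r ⊆ U` through every point of its preimage (the hypothesis
  `hsec` of `Complex.surjOn_and_isCoveringMap_of_holomorphicSections`), via the disc chart
  `w ↦ c + r·φ_{-p}(w)` (tree: `Complex.discMobius`);
* `Complex.mapsTo_connectedComponentIn_of_continuousOn`, `Complex.discLift_comp` — lifts through a chart
  `P : 𝔻 → ℂ` land in the component `U₀` of `P⁻¹(U)`, and based disc-lifting COMPOSES: if `F = P ∘ F₀`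
  with `F₀ : 𝔻 → U₀` and both `P` (for maps into `U`) and `F₀` (for maps into `U₀`) have it, so does `F`;
* `Complex.deriv_ne_zero_of_discLift`, `Complex.norm_deriv_le_of_extremal_lift` — EXTREMALITY DESCENDS:
  if `F` maximises `‖f′(0)‖` among holomorphic `f : 𝔻 → U` with `f 0 = F 0`, then its based lift `F₀`
  maximises `‖f′(0)‖` among holomorphic `f : 𝔻 → U₀` with `f 0 = 0` (FHW Part (c): the normalisation of
  the derivatives along the tower);
* **`Complex.exists_lambdaChart`** — FHW Lemma 3.1's `p`: for `a ≠ b` and `u₀ ∉ {a, b}` a holomorphic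
  `Λ : 𝔻 → ℂ ∖ {a, b}` with `Λ 0 = u₀` having based disc-lifting for holomorphic maps `𝔻 → ℂ ∖ {a, b}`
  (`Λ = a + (b - a)·λ ∘ Cayley⁻¹ ∘ φ_{-p}` with the tree's modular function `λ : ℍ → ℂ ∖ {0, 1}` and its
  holomorphic lifting `Literature.Analysis.Complex.exists_lift_modularLambda_of_differentiableOn`).

Classical mathematics; nothing here touches [IUTchIII] Cor. 3.12.
[cite: FisherHubbardWittner1988, Lemma 3.1 p.414, Part (c) p.415] [cite: Conway1978, Ch. VI Prop. 2.2]
-/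

noncomputable section

open Set Metric Filter Topology Function
open scoped ComplexConjugate

namespace Complex

/-! ### 1. Based disc-lifting gives holomorphic sections over discs -/

/-- **Sections from disc-lifting** (FHW Part (c), the «inverse image of a disc» step in Ũ-free form).
If every holomorphic `g : 𝔻 → U` lifts through `F` to a holomorphic self-map of `𝔻` with prescribed
base point over `g 0`, then over every disc `ball c r ⊆ U` and through every `z ∈ 𝔻` with
`F z ∈ ball c r` there is a holomorphic section `σ : ball c r → 𝔻` of `F` with `σ (F z) = z`: lift the
chart `t ↦ c + r·φ_{-p}(t)` (`p = (F z - c)/r`) at `z` and compose with its inverse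
`w ↦ φ_p((w - c)/r)`. [cite: FisherHubbardWittner1988, Part (c) p.415] -/
theorem holomorphicSections_of_discLift {U : Set ℂ} {F : ℂ → ℂ}
    (hlift : ∀ g : ℂ → ℂ, DifferentiableOn ℂ g (ball 0 1) → MapsTo g (ball 0 1) U →
      ∀ y ∈ ball (0 : ℂ) 1, F y = g 0 →
        ∃ gl : ℂ → ℂ, DifferentiableOn ℂ gl (ball 0 1) ∧ MapsTo gl (ball 0 1) (ball 0 1) ∧
          gl 0 = y ∧ ∀ t ∈ ball (0 : ℂ) 1, F (gl t) = g t) :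
    ∀ (c : ℂ) (r : ℝ), ball c r ⊆ U → ∀ z ∈ ball (0 : ℂ) 1, F z ∈ ball c r →
      ∃ σ : ℂ → ℂ, DifferentiableOn ℂ σ (ball c r) ∧ MapsTo σ (ball c r) (ball 0 1) ∧
        σ (F z) = z ∧ ∀ w ∈ ball c r, F (σ w) = w := by
  intro c r hBU z hz hFz
  have hr : 0 < r := nonempty_ball.mp ⟨_, hFz⟩
  have hr0 : (r : ℂ) ≠ 0 := ofReal_ne_zero.mpr hr.ne'
  have hnr : ‖(r : ℂ)‖ = r := by rw [norm_real, Real.norm_of_nonneg hr.le]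
  -- the point `p = (F z - c)/r` of the disc
  set p : ℂ := (F z - c) / r with hp
  have hp1 : ‖p‖ < 1 := by
    rw [hp, norm_div, hnr, div_lt_one hr, ← mem_ball_iff_norm]
    exact hFz
  have hnp1 : ‖-p‖ < 1 := by rwa [norm_neg]
  -- the affine part of the inverse chart maps `ball c r` into `𝔻`
  have hAd : DifferentiableOn ℂ (fun w : ℂ => (w - c) / r) (ball c r) :=
    (differentiableOn_id.sub_const c).div_const _
  have hAm : MapsTo (fun w : ℂ => (w - c) / r) (ball c r) (ball 0 1) := fun w hw => by
    rw [mem_ball_zero_iff, norm_div, hnr, div_lt_one hr, ← mem_ball_iff_norm]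
    exact hw
  -- the chart `χ t = c + r φ_{-p} t : 𝔻 → ball c r`, `χ 0 = F z`
  set χ : ℂ → ℂ := fun t => c + r * discMobius (-p) t with hχ
  have hχd : DifferentiableOn ℂ χ (ball 0 1) :=
    ((differentiableOn_discMobius hnp1).const_mul (r : ℂ)).const_add c
  have hχB : MapsTo χ (ball 0 1) (ball c r) := fun t ht => by
    rw [mem_ball_iff_norm, hχ]
    simp only [add_sub_cancel_left]
    rw [norm_mul, hnr]
    calc r * ‖discMobius (-p) t‖ < r * 1 :=
          mul_lt_mul_of_pos_left (norm_discMobius_lt_one hnp1 (mem_ball_zero_iff.mp ht)) hr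
      _ = r := mul_one r
  have hχ0 : χ 0 = F z := by
    simp only [hχ, discMobius_zero, neg_neg, hp]
    field_simp
    ring
  -- lift the chart through `F` at `z`
  obtain ⟨τ, hτd, hτD, hτ0, hτF⟩ := hlift χ hχd (hχB.mono_right hBU) z hz hχ0.symm
  refine ⟨fun w => τ (discMobius p ((w - c) / r)), ?_, ?_, ?_, ?_⟩
  · -- holomorphic
    have h1 : DifferentiableOn ℂ (discMobius p ∘ fun w : ℂ => (w - c) / r) (ball c r) :=
      (differentiableOn_discMobius hp1).comp hAd hAm
    have h2 : MapsTo (discMobius p ∘ fun w : ℂ => (w - c) / r) (ball c r) (ball 0 1) :=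
      (mapsTo_discMobius hp1).comp hAm
    exact hτd.comp h1 h2
  · -- into the disc
    intro w hw
    exact hτD (mapsTo_discMobius hp1 (hAm hw))
  · -- through `z`
    show τ (discMobius p p) = z
    rw [discMobius_self, hτ0]
  · -- a section of `F`
    intro w hw
    have hq : ‖(w - c) / (r : ℂ)‖ ≤ 1 := (mem_ball_zero_iff.mp (hAm hw)).le
    rw [hτF _ (mapsTo_discMobius hp1 (hAm hw))]
    show c + r * discMobius (-p) (discMobius p ((w - c) / r)) = w
    rw [discMobius_neg_discMobius hp1 hq]
    field_simp
    ring

/-! ### 2. Lifts through a chart land in one component; disc-lifting composes -/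

/-- **A holomorphic (continuous) image of the disc lies in one component.** If `τ` is continuous on
`𝔻` with `τ(𝔻) ⊆ S` and `τ 0` lies in the connected component of `x` in `S`, then `τ(𝔻)` lies in
that component (FHW Part (c): the liftings `f_n` take values in the component `U_n`).
[cite: FisherHubbardWittner1988, Part (c) p.415] -/
theorem mapsTo_connectedComponentIn_of_continuousOn {τ : ℂ → ℂ} {S : Set ℂ} {x : ℂ}
    (hτ : ContinuousOn τ (ball 0 1)) (hτS : MapsTo τ (ball 0 1) S)
    (hx : τ 0 ∈ connectedComponentIn S x) :
    MapsTo τ (ball 0 1) (connectedComponentIn S x) := by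
  have h1 : τ '' ball 0 1 ⊆ connectedComponentIn S (τ 0) :=
    ((convex_ball (0 : ℂ) 1).isPreconnected.image τ hτ).subset_connectedComponentIn
      (mem_image_of_mem τ (mem_ball_self one_pos)) hτS.image_subset
  rw [connectedComponentIn_eq hx]
  exact fun t ht => h1 (mem_image_of_mem τ ht)

/-- **Disc-lifting composes along a chart** (FHW Part (c): the liftings `f_n` factor the liftings of
`f_{n-1}`).  Let `P` have based disc-lifting for holomorphic maps `𝔻 → U`, let `U₀` be the connected
component of `0` in `𝔻 ∩ P⁻¹(U)`, and let `F₀ : 𝔻 → U₀` have based disc-lifting for holomorphic maps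
`𝔻 → U₀`.  If `F = P ∘ F₀` on `𝔻`, then `F` has based disc-lifting for holomorphic maps `𝔻 → U`.
[cite: FisherHubbardWittner1988, Part (c) p.415] -/
theorem discLift_comp {P F₀ F : ℂ → ℂ} {U : Set ℂ}
    (hPlift : ∀ g : ℂ → ℂ, DifferentiableOn ℂ g (ball 0 1) → MapsTo g (ball 0 1) U →
      ∀ y ∈ ball (0 : ℂ) 1, P y = g 0 →
        ∃ gl : ℂ → ℂ, DifferentiableOn ℂ gl (ball 0 1) ∧ MapsTo gl (ball 0 1) (ball 0 1) ∧
          gl 0 = y ∧ ∀ t ∈ ball (0 : ℂ) 1, P (gl t) = g t)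
    (hF₀U₀ : MapsTo F₀ (ball 0 1) (connectedComponentIn (ball 0 1 ∩ P ⁻¹' U) 0))
    (hF₀lift : ∀ g : ℂ → ℂ, DifferentiableOn ℂ g (ball 0 1) →
      MapsTo g (ball 0 1) (connectedComponentIn (ball 0 1 ∩ P ⁻¹' U) 0) →
      ∀ y ∈ ball (0 : ℂ) 1, F₀ y = g 0 →
        ∃ gl : ℂ → ℂ, DifferentiableOn ℂ gl (ball 0 1) ∧ MapsTo gl (ball 0 1) (ball 0 1) ∧
          gl 0 = y ∧ ∀ t ∈ ball (0 : ℂ) 1, F₀ (gl t) = g t)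
    (hPF : ∀ z ∈ ball (0 : ℂ) 1, P (F₀ z) = F z) :
    ∀ g : ℂ → ℂ, DifferentiableOn ℂ g (ball 0 1) → MapsTo g (ball 0 1) U →
      ∀ y ∈ ball (0 : ℂ) 1, F y = g 0 →
        ∃ gl : ℂ → ℂ, DifferentiableOn ℂ gl (ball 0 1) ∧ MapsTo gl (ball 0 1) (ball 0 1) ∧
          gl 0 = y ∧ ∀ t ∈ ball (0 : ℂ) 1, F (gl t) = g t := by
  intro g hg hgU y hy hFy
  have hF₀y : F₀ y ∈ ball (0 : ℂ) 1 := (connectedComponentIn_subset _ _ (hF₀U₀ hy)).1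
  -- lift `g` through `P` at `F₀ y`
  have hPy : P (F₀ y) = g 0 := by rw [hPF y hy]; exact hFy
  obtain ⟨τ, hτd, hτD, hτ0, hτP⟩ := hPlift g hg hgU (F₀ y) hF₀y hPy
  -- the lift lands in `U₀`
  have hτU₀ : MapsTo τ (ball 0 1) (connectedComponentIn (ball 0 1 ∩ P ⁻¹' U) 0) := by
    refine mapsTo_connectedComponentIn_of_continuousOn hτd.continuousOn
      (fun t ht => ⟨hτD ht, ?_⟩) ?_
    · show P (τ t) ∈ U
      rw [hτP t ht]
      exact hgU ht
    · rw [hτ0]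
      exact hF₀U₀ hy
  -- lift `τ` through `F₀` at `y`
  obtain ⟨σ, hσd, hσD, hσ0, hσF⟩ := hF₀lift τ hτd hτU₀ y hy hτ0.symm
  refine ⟨σ, hσd, hσD, hσ0, fun t ht => ?_⟩
  rw [← hPF _ (hσD ht), hσF t ht, hτP t ht]

/-! ### 3. Extremality descends along a chart -/

/-- **A chart with based disc-lifting has non-vanishing derivative over `U`** (`U` open): lift the
small disc `t ↦ P y + ε t` at `y` and differentiate (FHW Part (b): the tower maps are local
isomorphisms over `U`). [cite: FisherHubbardWittner1988, Part (b) p.415] -/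
theorem deriv_ne_zero_of_discLift {P : ℂ → ℂ} {U : Set ℂ} (hU : IsOpen U)
    (hP : DifferentiableOn ℂ P (ball 0 1))
    (hPlift : ∀ g : ℂ → ℂ, DifferentiableOn ℂ g (ball 0 1) → MapsTo g (ball 0 1) U →
      ∀ y ∈ ball (0 : ℂ) 1, P y = g 0 →
        ∃ gl : ℂ → ℂ, DifferentiableOn ℂ gl (ball 0 1) ∧ MapsTo gl (ball 0 1) (ball 0 1) ∧
          gl 0 = y ∧ ∀ t ∈ ball (0 : ℂ) 1, P (gl t) = g t)
    {y : ℂ} (hy : y ∈ ball (0 : ℂ) 1) (hPy : P y ∈ U) :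
    deriv P y ≠ 0 := by
  obtain ⟨ε, hε, hεU⟩ := Metric.isOpen_iff.mp hU (P y) hPy
  have hnε : ‖(ε : ℂ)‖ = ε := by rw [norm_real, Real.norm_of_nonneg hε.le]
  set g : ℂ → ℂ := fun t => P y + ε * t with hg
  have hgd : DifferentiableOn ℂ g (ball 0 1) :=
    (differentiableOn_id.const_mul (ε : ℂ)).const_add (P y)
  have hgU : MapsTo g (ball 0 1) U := fun t ht => hεU (by
    rw [mem_ball_iff_norm, hg]
    simp only [add_sub_cancel_left]
    rw [norm_mul, hnε]
    calc ε * ‖t‖ < ε * 1 := mul_lt_mul_of_pos_left (mem_ball_zero_iff.mp ht) hε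
      _ = ε := mul_one ε)
  have hg0 : P y = g 0 := by simp [hg]
  obtain ⟨gl, hgld, -, hgl0, hglP⟩ := hPlift g hgd hgU y hy hg0
  have h0D : (0 : ℂ) ∈ ball (0 : ℂ) 1 := mem_ball_self one_pos
  have h1 : HasDerivAt gl (deriv gl 0) 0 :=
    (hgld.differentiableAt (isOpen_ball.mem_nhds h0D)).hasDerivAt
  have h2 : HasDerivAt P (deriv P y) (gl 0) := by
    rw [hgl0]
    exact (hP.differentiableAt (isOpen_ball.mem_nhds hy)).hasDerivAt
  have hcomp : HasDerivAt (P ∘ gl) (deriv P y * deriv gl 0) 0 := h2.comp 0 h1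
  have hgder : HasDerivAt g ((ε : ℂ) * 1) 0 := by
    rw [hg]
    exact ((hasDerivAt_id (0 : ℂ)).const_mul (ε : ℂ)).const_add (P y)
  have hg' : HasDerivAt (P ∘ gl) ((ε : ℂ) * 1) 0 := by
    refine hgder.congr_of_eventuallyEq ?_
    filter_upwards [isOpen_ball.mem_nhds h0D] with t ht
    exact hglP t ht
  have heq := hcomp.unique hg'
  intro h0
  rw [h0, zero_mul, mul_one] at heq
  exact (ofReal_ne_zero.mpr hε.ne') heq.symm

/-- **Extremality descends** (FHW Part (c), normalisation of the derivatives along the tower, in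
Ũ-free form).  Let `P` be holomorphic on `𝔻` with `P′(0) ≠ 0`, `U₀ ⊆ 𝔻` with `P(U₀) ⊆ U`, and
`F = P ∘ F₀` on `𝔻` with `F₀ : 𝔻 → 𝔻` holomorphic, `F₀ 0 = 0`.  If `F` maximises `‖f′(0)‖` among
holomorphic `f : 𝔻 → U` with `f 0 = F 0`, then `F₀` maximises `‖f′(0)‖` among holomorphic `f : 𝔻 → U₀`
with `f 0 = 0`. [cite: FisherHubbardWittner1988, Part (c) p.415] -/
theorem norm_deriv_le_of_extremal_lift {P F₀ F : ℂ → ℂ} {U U₀ : Set ℂ}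
    (hP : DifferentiableOn ℂ P (ball 0 1)) (hP0 : deriv P 0 ≠ 0)
    (hU₀D : U₀ ⊆ ball 0 1) (hPU₀ : MapsTo P U₀ U)
    (hmax : ∀ g : ℂ → ℂ, DifferentiableOn ℂ g (ball 0 1) → MapsTo g (ball 0 1) U → g 0 = F 0 →
      ‖deriv g 0‖ ≤ ‖deriv F 0‖)
    (hF₀ : DifferentiableOn ℂ F₀ (ball 0 1)) (hF₀0 : F₀ 0 = 0)
    (hPF : ∀ z ∈ ball (0 : ℂ) 1, P (F₀ z) = F z) :
    ∀ g : ℂ → ℂ, DifferentiableOn ℂ g (ball 0 1) → MapsTo g (ball 0 1) U₀ → g 0 = 0 →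
      ‖deriv g 0‖ ≤ ‖deriv F₀ 0‖ := by
  intro g hg hgU₀ hg0
  have h0D : (0 : ℂ) ∈ ball (0 : ℂ) 1 := mem_ball_self one_pos
  have hgD : MapsTo g (ball 0 1) (ball 0 1) := hgU₀.mono_right hU₀D
  -- `P ∘ g` belongs to the `U`-family
  have hPg : DifferentiableOn ℂ (P ∘ g) (ball 0 1) := hP.comp hg hgD
  have hPgU : MapsTo (P ∘ g) (ball 0 1) U := hPU₀.comp hgU₀
  have hF0 : F 0 = P 0 := by rw [← hPF 0 h0D, hF₀0]
  have hPg0 : (P ∘ g) 0 = F 0 := by simp [hg0, hF0]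
  have hle := hmax (P ∘ g) hPg hPgU hPg0
  -- chain rules at `0`
  have hPd : DifferentiableAt ℂ P 0 := hP.differentiableAt (isOpen_ball.mem_nhds h0D)
  have hgd : DifferentiableAt ℂ g 0 := hg.differentiableAt (isOpen_ball.mem_nhds h0D)
  have hF₀d : DifferentiableAt ℂ F₀ 0 := hF₀.differentiableAt (isOpen_ball.mem_nhds h0D)
  have h1 : deriv (P ∘ g) 0 = deriv P 0 * deriv g 0 := by
    rw [deriv_comp 0 (by rw [hg0]; exact hPd) hgd, hg0]
  have h2 : deriv F 0 = deriv P 0 * deriv F₀ 0 := by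
    have hev : F =ᶠ[𝓝 0] (P ∘ F₀) := by
      filter_upwards [isOpen_ball.mem_nhds h0D] with z hz
      exact (hPF z hz).symm
    rw [hev.deriv_eq, deriv_comp 0 (by rw [hF₀0]; exact hPd) hF₀d, hF₀0]
  rw [h1, h2, norm_mul, norm_mul] at hle
  exact le_of_mul_le_mul_left hle (norm_pos_iff.mpr hP0)

/-! ### 4. The `λ`-chart of the twice-punctured plane -/

open Literature.NumberTheory.Automorphic Literature.NumberTheory.Automorphic.ModularLambda

/-- `τ + i ≠ 0` on the upper half-plane. [folklore] -/
private theorem add_I_ne_zero_of_im_pos {τ : ℂ} (hτ : 0 < τ.im) : τ + I ≠ 0 := by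
  intro h
  have := congrArg Complex.im h
  simp at this
  linarith

/-- The Cayley map `τ ↦ (τ - i)/(τ + i)` sends the upper half-plane into the unit disc. [folklore] -/
private theorem norm_cayley_lt_one {τ : ℂ} (hτ : 0 < τ.im) : ‖(τ - I) / (τ + I)‖ < 1 := by
  have hne := add_I_ne_zero_of_im_pos hτ
  rw [norm_div, div_lt_one (norm_pos_iff.2 hne)]
  have h1 : ‖τ - I‖ ^ 2 < ‖τ + I‖ ^ 2 := by
    rw [← Complex.normSq_eq_norm_sq, ← Complex.normSq_eq_norm_sq, Complex.normSq_apply,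
      Complex.normSq_apply]
    simp only [sub_re, I_re, sub_zero, sub_im, I_im, add_re, add_zero, add_im]
    nlinarith
  exact lt_of_pow_lt_pow_left₀ 2 (norm_nonneg _) h1

/-- `1 - w ≠ 0` for `‖w‖ < 1`. [folklore] -/
private theorem one_sub_ne_zero_of_norm_lt_one {w : ℂ} (hw : ‖w‖ < 1) : 1 - w ≠ 0 := by
  intro h
  have : w = 1 := by linear_combination -h
  rw [this, norm_one] at hw
  exact lt_irrefl _ hw

/-- The inverse Cayley map `w ↦ i(1 + w)/(1 - w)` sends the unit disc into the upper half-plane.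
[folklore] -/
private theorem im_cayleyInv_pos {w : ℂ} (hw : ‖w‖ < 1) : 0 < (I * (1 + w) / (1 - w)).im := by
  have hne := one_sub_ne_zero_of_norm_lt_one hw
  have hns : 0 < Complex.normSq (1 - w) := Complex.normSq_pos.2 hne
  rw [Complex.div_im]
  simp only [mul_re, I_re, one_re, add_re, zero_mul, I_im, add_im, one_im, zero_add, one_mul,
    zero_sub, sub_re, sub_im, mul_im]
  have hw2 : w.re * w.re + w.im * w.im < 1 := by
    have : ‖w‖ ^ 2 < 1 := by nlinarith [norm_nonneg w]
    rwa [← Complex.normSq_eq_norm_sq, Complex.normSq_apply] at this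
  rw [div_sub_div_same]
  exact div_pos (by nlinarith) hns

/-- `Cayley⁻¹ ∘ Cayley = id` on the upper half-plane. [folklore] -/
private theorem cayleyInv_cayley {τ : ℂ} (hτ : 0 < τ.im) :
    I * (1 + (τ - I) / (τ + I)) / (1 - (τ - I) / (τ + I)) = τ := by
  have hne := add_I_ne_zero_of_im_pos hτ
  have h2 : (1 : ℂ) - (τ - I) / (τ + I) = 2 * I / (τ + I) := by
    field_simp
    ring
  have h3 : (1 : ℂ) + (τ - I) / (τ + I) = 2 * τ / (τ + I) := by
    field_simp
    ring
  rw [h2, h3]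
  have hI : (2 : ℂ) * I ≠ 0 := mul_ne_zero two_ne_zero I_ne_zero
  field_simp

/-- `Cayley ∘ Cayley⁻¹ = id` on the unit disc. [folklore] -/
private theorem cayley_cayleyInv {w : ℂ} (hw : ‖w‖ < 1) :
    (I * (1 + w) / (1 - w) - I) / (I * (1 + w) / (1 - w) + I) = w := by
  have hne := one_sub_ne_zero_of_norm_lt_one hw
  have h2 : I * (1 + w) / (1 - w) - I = 2 * I * w / (1 - w) := by
    field_simp
    ring
  have h3 : I * (1 + w) / (1 - w) + I = 2 * I / (1 - w) := by
    field_simp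
    ring
  rw [h2, h3]
  have hI : (2 : ℂ) * I ≠ 0 := mul_ne_zero two_ne_zero I_ne_zero
  field_simp

/-- The unit disc is simply connected (convex, hence contractible). [folklore] -/
private theorem isSimplyConnected_unitBall : IsSimplyConnected (ball (0 : ℂ) 1) := by
  have : ContractibleSpace (ball (0 : ℂ) 1) :=
    (convex_ball (0 : ℂ) 1).contractibleSpace ⟨0, mem_ball_self one_pos⟩
  change SimplyConnectedSpace (ball (0 : ℂ) 1)
  infer_instance

/-- **The `λ`-chart of `ℂ ∖ {0, 1}` at a prescribed point** (FHW Lemma 3.1's universal covering `p`,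
normalised): for `u₀ ≠ 0, 1` there is `Λ`, holomorphic on `𝔻`, omitting `0` and `1` on `𝔻`, with
`Λ 0 = u₀`, such that every holomorphic `g : 𝔻 → ℂ ∖ {0, 1}` lifts through `Λ` to a holomorphic
self-map of `𝔻` with any prescribed base point over `g 0`.  (`Λ = λ ∘ Cayley⁻¹ ∘ φ_{-p}` with `λ` the
modular function of the tree and `φ` the disc automorphism.) [cite: FisherHubbardWittner1988, Lemma 3.1 p.414] -/
theorem exists_lambdaChart_zero_one {u₀ : ℂ} (hu₀ : u₀ ≠ 0) (hu₁ : u₀ ≠ 1) :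
    ∃ Λ : ℂ → ℂ, DifferentiableOn ℂ Λ (ball 0 1) ∧ (∀ z ∈ ball (0 : ℂ) 1, Λ z ≠ 0 ∧ Λ z ≠ 1) ∧
      Λ 0 = u₀ ∧
      ∀ g : ℂ → ℂ, DifferentiableOn ℂ g (ball 0 1) → (∀ t ∈ ball (0 : ℂ) 1, g t ≠ 0 ∧ g t ≠ 1) →
        ∀ y ∈ ball (0 : ℂ) 1, Λ y = g 0 →
          ∃ gl : ℂ → ℂ, DifferentiableOn ℂ gl (ball 0 1) ∧ MapsTo gl (ball 0 1) (ball 0 1) ∧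
            gl 0 = y ∧ ∀ t ∈ ball (0 : ℂ) 1, Λ (gl t) = g t := by
  classical
  obtain ⟨τ₀, hτ₀, hlamτ₀⟩ := exists_modularLambda_eq hu₀ hu₁
  -- Cayley maps and the base point `p = C τ₀ ∈ 𝔻`
  set C : ℂ → ℂ := fun τ => (τ - I) / (τ + I) with hC
  set Ci : ℂ → ℂ := fun w => I * (1 + w) / (1 - w) with hCi
  set p : ℂ := C τ₀ with hp
  have hp1 : ‖p‖ < 1 := norm_cayley_lt_one hτ₀
  have hnp1 : ‖-p‖ < 1 := by rwa [norm_neg]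
  have hCi_im : ∀ w ∈ ball (0 : ℂ) 1, 0 < (Ci w).im := fun w hw =>
    im_cayleyInv_pos (mem_ball_zero_iff.mp hw)
  have hCid : DifferentiableOn ℂ Ci (ball 0 1) := fun w hw =>
    (((differentiableAt_const I).mul (differentiableAt_id.const_add 1)).div
      ((differentiableAt_const (1 : ℂ)).sub differentiableAt_id)
      (one_sub_ne_zero_of_norm_lt_one (mem_ball_zero_iff.mp hw))).differentiableWithinAt
  have hlamd : ∀ τ : ℂ, 0 < τ.im → DifferentiableAt ℂ modularLambda τ := fun τ hτ =>
    differentiableOn_modularLambda.differentiableAt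
      ((isOpen_lt continuous_const Complex.continuous_im).mem_nhds hτ)
  -- the chart
  set Λ : ℂ → ℂ := fun z => modularLambda (Ci (discMobius (-p) z)) with hΛ
  have hΛim : ∀ z ∈ ball (0 : ℂ) 1, 0 < (Ci (discMobius (-p) z)).im := fun z hz =>
    hCi_im _ (mapsTo_discMobius hnp1 hz)
  refine ⟨Λ, ?_, ?_, ?_, ?_⟩
  · -- holomorphic on `𝔻`
    intro z hz
    have h1 : DifferentiableAt ℂ (discMobius (-p)) z :=
      differentiableAt_discMobius hnp1 (mem_ball_zero_iff.mp hz).le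
    have h2 : DifferentiableAt ℂ Ci (discMobius (-p) z) :=
      hCid.differentiableAt (isOpen_ball.mem_nhds (mapsTo_discMobius hnp1 hz))
    have h3 : DifferentiableAt ℂ modularLambda (Ci (discMobius (-p) z)) := hlamd _ (hΛim z hz)
    exact (h3.comp z (h2.comp z h1)).differentiableWithinAt
  · -- omits `0` and `1`
    intro z hz
    exact ⟨modularLambda_ne_zero (hΛim z hz), modularLambda_ne_one (hΛim z hz)⟩
  · -- `Λ 0 = u₀`
    show modularLambda (Ci (discMobius (-p) 0)) = u₀
    rw [discMobius_zero, neg_neg, hp, hC, hCi]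
    simp only
    rw [cayleyInv_cayley hτ₀, hlamτ₀]
  · -- based disc-lifting through `Λ`
    intro g hg hg01 y hy hΛy
    -- the base point upstairs
    set τ₁ : ℂ := Ci (discMobius (-p) y) with hτ₁
    have hτ₁im : 0 < τ₁.im := hΛim y hy
    have hc : modularLambda τ₁ = g 0 := hΛy
    obtain ⟨G, hGd, hGim, hG0, hGlam⟩ :=
      Literature.Analysis.Complex.exists_lift_modularLambda_of_differentiableOn isOpen_ball
        isSimplyConnected_unitBall (mem_ball_self one_pos) hτ₁im hg (fun t ht => (hg01 t ht).1)
        (fun t ht => (hg01 t ht).2) hc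
    -- push the lift down to the disc: `gl = φ_p ∘ C ∘ G`
    refine ⟨fun t => discMobius p (C (G t)), ?_, ?_, ?_, ?_⟩
    · intro t ht
      have h1 : DifferentiableAt ℂ G t := hGd.differentiableAt (isOpen_ball.mem_nhds ht)
      have h2 : DifferentiableAt ℂ C (G t) :=
        (differentiableAt_id.sub_const I).div (differentiableAt_id.add_const I)
          (add_I_ne_zero_of_im_pos (hGim t ht))
      have h3 : DifferentiableAt ℂ (discMobius p) (C (G t)) :=
        differentiableAt_discMobius hp1 (norm_cayley_lt_one (hGim t ht)).le
      exact (h3.comp t (h2.comp t h1)).differentiableWithinAt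
    · intro t ht
      exact mapsTo_discMobius hp1 (mem_ball_zero_iff.mpr (norm_cayley_lt_one (hGim t ht)))
    · -- base point: `φ_p (C (Ci (φ_{-p} y))) = y`
      show discMobius p (C (G 0)) = y
      rw [hG0, hτ₁, hC, hCi]
      simp only
      rw [cayley_cayleyInv (mem_ball_zero_iff.mp (mapsTo_discMobius hnp1 hy))]
      have h := discMobius_neg_discMobius (a := -p) hnp1 (mem_ball_zero_iff.mp hy).le
      rwa [neg_neg] at h
    · -- `Λ ∘ gl = g`
      intro t ht
      have hCt : ‖C (G t)‖ < 1 := norm_cayley_lt_one (hGim t ht)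
      show modularLambda (Ci (discMobius (-p) (discMobius p (C (G t))))) = g t
      rw [discMobius_neg_discMobius hp1 hCt.le, hC, hCi]
      simp only
      rw [cayleyInv_cayley (hGim t ht), hGlam t ht]

/-- **The `λ`-chart of `ℂ ∖ {a, b}`** (`a ≠ b`, `u₀ ∉ {a, b}`): a holomorphic `Λ : 𝔻 → ℂ ∖ {a, b}` with
`Λ 0 = u₀` through which every holomorphic `g : 𝔻 → ℂ ∖ {a, b}` lifts to a holomorphic self-map of `𝔻`
with any prescribed base point over `g 0` — the affine image `a + (b - a)·Λ₀` of the chart of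
`ℂ ∖ {0, 1}`. [cite: FisherHubbardWittner1988, Lemma 3.1 p.414] -/
theorem exists_lambdaChart {a b u₀ : ℂ} (hab : a ≠ b) (hua : u₀ ≠ a) (hub : u₀ ≠ b) :
    ∃ Λ : ℂ → ℂ, DifferentiableOn ℂ Λ (ball 0 1) ∧ (∀ z ∈ ball (0 : ℂ) 1, Λ z ≠ a ∧ Λ z ≠ b) ∧
      Λ 0 = u₀ ∧
      ∀ g : ℂ → ℂ, DifferentiableOn ℂ g (ball 0 1) → (∀ t ∈ ball (0 : ℂ) 1, g t ≠ a ∧ g t ≠ b) →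
        ∀ y ∈ ball (0 : ℂ) 1, Λ y = g 0 →
          ∃ gl : ℂ → ℂ, DifferentiableOn ℂ gl (ball 0 1) ∧ MapsTo gl (ball 0 1) (ball 0 1) ∧
            gl 0 = y ∧ ∀ t ∈ ball (0 : ℂ) 1, Λ (gl t) = g t := by
  have hba : b - a ≠ 0 := sub_ne_zero.mpr hab.symm
  -- the affine normalisation `A w = (w - a)/(b - a)` and its inverse
  have hA0 : ∀ w : ℂ, (w - a) / (b - a) = 0 ↔ w = a := fun w => by
    rw [div_eq_zero_iff, or_iff_left hba, sub_eq_zero]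
  have hA1 : ∀ w : ℂ, (w - a) / (b - a) = 1 ↔ w = b := fun w => by
    rw [div_eq_one_iff_eq hba, sub_left_inj]
  obtain ⟨Λ₀, hΛ₀d, hΛ₀01, hΛ₀0, hΛ₀lift⟩ :=
    exists_lambdaChart_zero_one (u₀ := (u₀ - a) / (b - a)) (fun h => hua ((hA0 u₀).mp h))
      (fun h => hub ((hA1 u₀).mp h))
  refine ⟨fun z => a + (b - a) * Λ₀ z, (hΛ₀d.const_mul (b - a)).const_add a, ?_, ?_, ?_⟩
  · intro z hz
    obtain ⟨h0, h1⟩ := hΛ₀01 z hz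
    refine ⟨fun h => h0 ?_, fun h => h1 ?_⟩
    · have : (b - a) * Λ₀ z = 0 := by linear_combination h
      exact (mul_eq_zero.mp this).resolve_left hba
    · have : (b - a) * (Λ₀ z - 1) = 0 := by linear_combination h
      exact sub_eq_zero.mp ((mul_eq_zero.mp this).resolve_left hba)
  · show a + (b - a) * Λ₀ 0 = u₀
    rw [hΛ₀0]
    field_simp
    ring
  · intro g hg hgab y hy hΛy
    -- normalise `g`
    set g₀ : ℂ → ℂ := fun t => (g t - a) / (b - a) with hg₀
    have hg₀d : DifferentiableOn ℂ g₀ (ball 0 1) := (hg.sub_const a).div_const _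
    have hg₀01 : ∀ t ∈ ball (0 : ℂ) 1, g₀ t ≠ 0 ∧ g₀ t ≠ 1 := fun t ht =>
      ⟨fun h => (hgab t ht).1 ((hA0 _).mp h), fun h => (hgab t ht).2 ((hA1 _).mp h)⟩
    have hΛ₀y : Λ₀ y = g₀ 0 := by
      rw [hg₀]
      simp only
      rw [← hΛy]
      field_simp
      ring
    obtain ⟨gl, hgld, hglD, hgl0, hglΛ⟩ := hΛ₀lift g₀ hg₀d hg₀01 y hy hΛ₀y
    refine ⟨gl, hgld, hglD, hgl0, fun t ht => ?_⟩
    show a + (b - a) * Λ₀ (gl t) = g t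
    rw [hglΛ t ht, hg₀]
    simp only
    field_simp
    ring

end Complex

end
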